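import Summits.CriticalPhenomena.PercolationContinuityZ3.Theorems.PercNearOneGluingNoHeavyLowerTailKnQuestion8CoefficientwiseCoreClassKernelMixTwoArmsCycles

/-!
# Two-arm gluing for the chordless two-type inequality, VI: blocks of length two (digons)

Support file (`--supports stmt-CriticalPhenomena-4575`, closed), prover `prim-cplus-coupling` (gen 72).  No definitions, no named
facts, no sorries; standard axioms.  Memo `prim-cplus-coupling/A5-COUPLING-gen71.md` §2 / `A5-COUPLING-gen72.md` §7.3: the abstract
two-arm theorem `TwoArms.two_arms_product` needs, for each block, only the single-block ('chorded') two-type inequality (X2₁); for a cycle of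
length `≥ 3` this is `TwoArms.x2_cycleWords`.  Here the remaining block type of a chordless bouquet is supplied:

* `TwoArms.x2_digonWords` — (X2₁) on the digon lattice `Bool × Bool` (levels `SmallCycles.DigonLevel`, mirror `(¬a, ¬b)`), i.e.
  `Bouquet.HBundle.x2` of the one-digon bouquet `HBundle.unit.consDigon` transported along `Unit × (Bool × Bool) ≃ Bool × Bool`;
* `TwoArms.two_arms_digon_cycle` — the chordless two-type inequality (X2) for the bouquet `C₂ + C_{|β|+2}` (a digon and a cycle of
  length `≥ 3`), all digon/cycle levels consistent at the corner, all upper families `A, C`;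
* `TwoArms.two_arms_digon_digon` — the same for the bouquet of two digons.
Together with `two_arms_cycles` this covers every two-block chordless bouquet with block lengths `≥ 2` (the `r = 2` case of the lane's
chordless two-type conjecture; loops = chords belong to the chorded theorem `Bouquet.HBundle.x2`).
[cite: KozmaNitzan2024, Questions 8–9 (§5.5 p. 36) (context); Harris 1960; Kleitman 1966]
-/

namespace Summit.CriticalPhenomena.PercolationContinuityZ3.Theorems.Coefficientwise.TwoArms

open Finset Bouquet CycleWords CycleFactor ReducedKleitman HSpace SmallCycles

/-- The mirror of a digon word. -/
private theorem digon_mirror_invol : Function.Involutive (fun w : Bool × Bool => (!w.1, !w.2)) := by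
  intro w; obtain ⟨a, b⟩ := w; simp

/-- **The single-digon chorded two-type inequality on digon words** (`Bouquet.HBundle.x2` for the one-digon bouquet, transported from
`Unit × (Bool × Bool)`): for digon levels `D, B` (`SmallCycles.DigonLevel`) and upper families `A, C` of `Bool × Bool`,
`#((A∖C)∩(D∖B)) + #((C∖A)∩(B∖D)) ≤ #((A∖C)∩{cw ∈ D}) + #((C∖A)∩{cw ∈ B}) + #(A∩C∩(univ∖⊥)) + #(A∩C∩((univ∖⊤)∖(D∪B)))`. -/
theorem x2_digonWords (D B : Finset (Bool × Bool)) (hD : DigonLevel D) (hB : DigonLevel B)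
    (A C : Finset (Bool × Bool)) (hA : IsUpperSet (A : Set (Bool × Bool))) (hC : IsUpperSet (C : Set (Bool × Bool))) :
    ((A \ C) ∩ (D \ B)).card + ((C \ A) ∩ (B \ D)).card ≤
      ((A \ C) ∩ univ.filter (fun x : Bool × Bool => (!x.1, !x.2) ∈ D)).card +
          ((C \ A) ∩ univ.filter (fun x : Bool × Bool => (!x.1, !x.2) ∈ B)).card +
        (A ∩ C ∩ univ.erase (false, false)).card + (A ∩ C ∩ (univ.erase (true, true) \ (D ∪ B))).card := by
  classical
  set H : HBundle := HBundle.unit.consDigon with hH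
  let e : (Bool × Bool) ↪ H.X := ⟨fun w => ((), w), fun w w' h => (Prod.mk.injEq _ _ _ _ ▸ h).2⟩
  have he : ∀ (S : Finset (Bool × Bool)) (z : H.X), z ∈ S.map e ↔ z.2 ∈ S := by
    intro S z
    obtain ⟨u, w⟩ := z
    constructor
    · intro hz
      obtain ⟨a, ha, hz⟩ := mem_map.mp hz
      have : a = w := (Prod.mk.injEq _ _ _ _ ▸ hz).2
      exact this ▸ ha
    · intro hw
      exact mem_map.mpr ⟨w, hw, by show ((), w) = (u, w); rfl⟩
  have hc2 : ∀ z : H.X, (H.c z).2 = (!z.2.1, !z.2.2) := fun z => rfl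
  have hNF : ∀ z : H.X, z ∈ H.NF ↔ z.2 ∈ univ.erase (true, true) := by
    intro z
    obtain ⟨u, w⟩ := z
    change (u, w) ∈ HBundle.unit.NF ×ˢ univ.erase (true, true) ↔ w ∈ univ.erase (true, true)
    exact ⟨fun h => (mem_product.mp h).2,
      fun h => mem_product.mpr ⟨show u ∈ ({()} : Finset Unit) from mem_singleton.mpr rfl, h⟩⟩
  have hlev : ∀ S : Finset (Bool × Bool), DigonLevel S → H.Level (S.map e) := by
    intro S hS
    have hfib : ∀ x : Unit, fibL (S.map e) x = S := by
      intro x; ext w; exact mem_fibL.trans (he S (x, w))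
    show (∀ x, DigonLevel (fibL (S.map e) x)) ∧ (∀ v, HBundle.unit.Level (fibR (S.map e) v))
    exact ⟨fun x => by rw [hfib x]; exact hS, fun _ => trivial⟩
  have hup : ∀ S : Finset (Bool × Bool), IsUpperSet (S : Set (Bool × Bool)) →
      IsUpperSet ((S.map e : Finset H.X) : Set H.X) := by
    intro S hS a b hab ha
    rw [mem_coe, he] at ha ⊢
    exact hS hab.2 ha
  have htop : ∀ S : Finset (Bool × Bool), DigonLevel S → ((true, true) : Bool × Bool) ∉ S := by
    intro S hS h
    rcases hS with h' | h'
    · rw [h'] at h; simp at h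
    · rw [h'] at h; simp at h
  have hNE : ∀ S : Finset (Bool × Bool), DigonLevel S →
      univ.filter (fun x : H.X => H.c x ∈ S.map e) ⊆ (univ.erase (false, false)).map e := by
    intro S hS z hz
    rw [he]
    have h := (mem_filter.mp hz).2
    rw [he, hc2] at h
    refine mem_erase.mpr ⟨fun hb => htop S hS ?_, mem_univ _⟩
    have h1 : z.2.1 = false := (Prod.mk.injEq _ _ _ _ ▸ hb).1
    have h2 : z.2.2 = false := (Prod.mk.injEq _ _ _ _ ▸ hb).2
    rw [h1, h2] at h
    exact h
  have h := H.x2 (D.map e) (B.map e) (hlev D hD) (hlev B hB) ((univ.erase (false, false)).map e) (hNE D hD) (hNE B hB)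
    (A.map e) (C.map e) (hup A hA) (hup C hC)
  have t1 : (A.map e \ C.map e) ∩ (D.map e \ B.map e) = ((A \ C) ∩ (D \ B)).map e := by
    ext z; simp only [mem_inter, mem_sdiff, he]
  have t2 : (C.map e \ A.map e) ∩ (B.map e \ D.map e) = ((C \ A) ∩ (B \ D)).map e := by
    ext z; simp only [mem_inter, mem_sdiff, he]
  have t3 : (A.map e \ C.map e) ∩ univ.filter (fun x : H.X => H.c x ∈ D.map e) =
      ((A \ C) ∩ univ.filter (fun x : Bool × Bool => (!x.1, !x.2) ∈ D)).map e := by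
    ext z; simp only [mem_inter, mem_sdiff, mem_filter, mem_univ, true_and, he, hc2]
  have t4 : (C.map e \ A.map e) ∩ univ.filter (fun x : H.X => H.c x ∈ B.map e) =
      ((C \ A) ∩ univ.filter (fun x : Bool × Bool => (!x.1, !x.2) ∈ B)).map e := by
    ext z; simp only [mem_inter, mem_sdiff, mem_filter, mem_univ, true_and, he, hc2]
  have t5 : A.map e ∩ C.map e ∩ (univ.erase (false, false)).map e = (A ∩ C ∩ univ.erase (false, false)).map e := by
    ext z; simp only [mem_inter, he]
  have t6 : A.map e ∩ C.map e ∩ (H.NF \ (D.map e ∪ B.map e)) = (A ∩ C ∩ (univ.erase (true, true) \ (D ∪ B))).map e := by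
    ext z; simp only [mem_inter, mem_sdiff, mem_union, he, hNF]
  rw [t1, t2, t3, t4, t5, t6, card_map, card_map, card_map, card_map, card_map, card_map] at h
  exact h

/-- Lower-set and top-exclusion facts for a digon level. -/
private theorem digonLevel_lower {S : Finset (Bool × Bool)} (hS : DigonLevel S) :
    IsLowerSet (S : Set (Bool × Bool)) ∧ ((true, true) : Bool × Bool) ∉ S := by
  rcases hS with h | h
  · subst h
    exact ⟨by intro a b _ ha; simp at ha, by simp⟩
  · subst h
    refine ⟨?_, by simp⟩
    intro a b hba ha
    rw [mem_coe, mem_erase] at ha ⊢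
    refine ⟨fun hb => ha.1 ?_, mem_univ _⟩
    rw [hb] at hba
    obtain ⟨a1, a2⟩ := a
    have h1 : true ≤ a1 := hba.1
    have h2 : true ≤ a2 := hba.2
    revert h1 h2
    cases a1 <;> cases a2 <;> decide

/-- **THEOREM (chordless two-type inequality for a digon glued to a cycle).**  For the digon lattice `Bool × Bool` (digon levels
`Dα, Bα`) and a cycle with interior edge type `β` (nonempty; `CycleWords.IsLevel` levels `Dβ, Bβ`), consistent at the corner, the chordless
levels `D = {⊥}×Dβ ∪ Dα×{⊥}`, `B` likewise, demand region `G = {⊥}×(univ∖⊤) ∪ (univ∖⊤)×{⊥}` on `(Bool × Bool) × W_β`, and all upper families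
`A, C`: the two-type inequality (X2).  (`two_arms_product` + `x2_digonWords` + `x2_cycleWords`.) -/
theorem two_arms_digon_cycle {β : Type} [Fintype β] [DecidableEq β] [Nonempty β]
    (Dα Bα : Finset (Bool × Bool)) (Dβ Bβ : Finset (Bool × Finset β × Bool))
    (hDα : DigonLevel Dα) (hBα : DigonLevel Bα) (hDβ : IsLevel Dβ) (hBβ : IsLevel Bβ)
    (hDc : ((false, false) : Bool × Bool) ∈ Dα ↔ botW β ∈ Dβ) (hBc : ((false, false) : Bool × Bool) ∈ Bα ↔ botW β ∈ Bβ)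
    (Dz Bz Gz : Finset ((Bool × Bool) × (Bool × Finset β × Bool)))
    (hDz : Dz = Dβ.image (fun q => (((false, false) : Bool × Bool), q)) ∪ Dα.image (fun p => (p, botW β)))
    (hBz : Bz = Bβ.image (fun q => (((false, false) : Bool × Bool), q)) ∪ Bα.image (fun p => (p, botW β)))
    (hGz : Gz = (univ.erase (topW β)).image (fun q => (((false, false) : Bool × Bool), q)) ∪
      (univ.erase ((true, true) : Bool × Bool)).image (fun p => (p, botW β)))
    (A C : Finset ((Bool × Bool) × (Bool × Finset β × Bool)))
    (hA : IsUpperSet (A : Set ((Bool × Bool) × (Bool × Finset β × Bool))))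
    (hC : IsUpperSet (C : Set ((Bool × Bool) × (Bool × Finset β × Bool)))) :
    ((A \ C) ∩ (Dz \ Bz)).card + ((C \ A) ∩ (Bz \ Dz)).card ≤
      ((A \ C) ∩ @Finset.filter _ (fun z : (Bool × Bool) × (Bool × Finset β × Bool) => ((!z.1.1, !z.1.2), cw z.2) ∈ Dz)
            (fun _ => inferInstance) univ).card +
          ((C \ A) ∩ @Finset.filter _ (fun z : (Bool × Bool) × (Bool × Finset β × Bool) => ((!z.1.1, !z.1.2), cw z.2) ∈ Bz)
            (fun _ => inferInstance) univ).card +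
        (A ∩ C ∩ @Finset.filter _ (fun z : (Bool × Bool) × (Bool × Finset β × Bool) => ((!z.1.1, !z.1.2), cw z.2) ∈ Gz)
            (fun _ => inferInstance) univ).card +
        (A ∩ C ∩ (Gz \ (Dz ∪ Bz))).card :=
  two_arms_product ((false, false) : Bool × Bool) (true, true) (fun w => (!w.1, !w.2)) Dα Bα
    (fun p => Prod.le_def.mpr ⟨Bool.false_le _, Bool.false_le _⟩) (fun p => Prod.le_def.mpr ⟨Bool.le_true _, Bool.le_true _⟩) (by simp) digon_mirror_invol rfl
    (digonLevel_lower hDα).1 (digonLevel_lower hBα).1 (digonLevel_lower hDα).2 (digonLevel_lower hBα).2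
    (fun A' C' hA' hC' => x2_digonWords Dα Bα hDα hBα A' C' hA' hC')
    (botW β) (topW β) cw Dβ Bβ botW_le le_topW botW_ne_topW cw_cw cw_botW hDβ.2.1 hBβ.2.1
    (fun A' C' hA' hC' => x2_cycleWords Dβ Bβ hDβ hBβ A' C' hA' hC')
    hDc hBc Dz Bz Gz hDz hBz hGz A C hA hC

/-- **THEOREM (chordless two-type inequality for the bouquet of two digons).**  As `two_arms_digon_cycle` with both blocks digons. -/
theorem two_arms_digon_digon
    (Dα Bα Dβ Bβ : Finset (Bool × Bool))
    (hDα : DigonLevel Dα) (hBα : DigonLevel Bα) (hDβ : DigonLevel Dβ) (hBβ : DigonLevel Bβ)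
    (hDc : ((false, false) : Bool × Bool) ∈ Dα ↔ ((false, false) : Bool × Bool) ∈ Dβ)
    (hBc : ((false, false) : Bool × Bool) ∈ Bα ↔ ((false, false) : Bool × Bool) ∈ Bβ)
    (Dz Bz Gz : Finset ((Bool × Bool) × (Bool × Bool)))
    (hDz : Dz = Dβ.image (fun q => (((false, false) : Bool × Bool), q)) ∪ Dα.image (fun p => (p, ((false, false) : Bool × Bool))))
    (hBz : Bz = Bβ.image (fun q => (((false, false) : Bool × Bool), q)) ∪ Bα.image (fun p => (p, ((false, false) : Bool × Bool))))
    (hGz : Gz = (univ.erase ((true, true) : Bool × Bool)).image (fun q => (((false, false) : Bool × Bool), q)) ∪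
      (univ.erase ((true, true) : Bool × Bool)).image (fun p => (p, ((false, false) : Bool × Bool))))
    (A C : Finset ((Bool × Bool) × (Bool × Bool)))
    (hA : IsUpperSet (A : Set ((Bool × Bool) × (Bool × Bool)))) (hC : IsUpperSet (C : Set ((Bool × Bool) × (Bool × Bool)))) :
    ((A \ C) ∩ (Dz \ Bz)).card + ((C \ A) ∩ (Bz \ Dz)).card ≤
      ((A \ C) ∩ @Finset.filter _ (fun z : (Bool × Bool) × (Bool × Bool) => ((!z.1.1, !z.1.2), (!z.2.1, !z.2.2)) ∈ Dz)
            (fun _ => inferInstance) univ).card +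
          ((C \ A) ∩ @Finset.filter _ (fun z : (Bool × Bool) × (Bool × Bool) => ((!z.1.1, !z.1.2), (!z.2.1, !z.2.2)) ∈ Bz)
            (fun _ => inferInstance) univ).card +
        (A ∩ C ∩ @Finset.filter _ (fun z : (Bool × Bool) × (Bool × Bool) => ((!z.1.1, !z.1.2), (!z.2.1, !z.2.2)) ∈ Gz)
            (fun _ => inferInstance) univ).card +
        (A ∩ C ∩ (Gz \ (Dz ∪ Bz))).card :=
  two_arms_product ((false, false) : Bool × Bool) (true, true) (fun w => (!w.1, !w.2)) Dα Bα
    (fun p => Prod.le_def.mpr ⟨Bool.false_le _, Bool.false_le _⟩) (fun p => Prod.le_def.mpr ⟨Bool.le_true _, Bool.le_true _⟩) (by simp) digon_mirror_invol rfl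
    (digonLevel_lower hDα).1 (digonLevel_lower hBα).1 (digonLevel_lower hDα).2 (digonLevel_lower hBα).2
    (fun A' C' hA' hC' => x2_digonWords Dα Bα hDα hBα A' C' hA' hC')
    ((false, false) : Bool × Bool) (true, true) (fun w => (!w.1, !w.2)) Dβ Bβ
    (fun p => Prod.le_def.mpr ⟨Bool.false_le _, Bool.false_le _⟩) (fun p => Prod.le_def.mpr ⟨Bool.le_true _, Bool.le_true _⟩) (by simp) digon_mirror_invol rfl
    (digonLevel_lower hDβ).2 (digonLevel_lower hBβ).2
    (fun A' C' hA' hC' => x2_digonWords Dβ Bβ hDβ hBβ A' C' hA' hC')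
    hDc hBc Dz Bz Gz hDz hBz hGz A C hA hC

end Summit.CriticalPhenomena.PercolationContinuityZ3.Theorems.Coefficientwise.TwoArms
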